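import Mathlib
import HarnessLib
import Literature.Computability.LopesEtAl2021.Refinement

/-!
# LLVM Language Reference Manual, release 18.1.3: §'Undefined Values' — the printed Safe / Unsafe examples as theorems, the `noundef` attribute, 'Well-Defined Values'

Source followed verbatim: *LLVM Language Reference Manual*, release 18.1.3 [LLVMLangRef18] — `docs/LangRef.rst` at tag `llvmorg-18.1.3`
(pinned copy `inputs/llvm-18.1.3.src/docs/LangRef.rst` of the CertifiedToolchain cell).  Fourth companion of `IntegerIntrinsics`,
`BinaryOperators`, `BitManipulationIntrinsics` (which type the instructions on the poison-or-defined domain and say "nothing about `undef`").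
THIS file types what the manual says about `undef`, in the VALUE-SET model already typed from Alive2 (`LopesEtAl2021.Val`: a value is
`poison` or a set of defined values, `undef = vals Set.univ`, a well-defined value `defined a = vals {a}`; an instruction maps operand SETS
to the set of all results over INDEPENDENT picks, `Val.map₂`; refinement `Refines src tgt`: `poison` is refined by anything, `vals s` by
`vals s'` iff `s' ⊆ s`).  Every example the section prints as "Safe" is proved a refinement, every "Unsafe" one is refuted by a witness.

Printed (§'Undefined Values', L4366–4369): "The string '``undef``' can be used anywhere a constant is expected, and indicates that the user of
the value may receive an unspecified bit-pattern."  (L4373–4376, Note): "A '``poison``' value (described in the next section) should be used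
instead of '``undef``' whenever possible. Poison values are stronger than undef, and enable more optimizations."  (L4378–4381): "Undefined
values are useful because they indicate to the compiler that the program is well defined no matter what value is used. This gives the
compiler more freedom to optimize."  (L4393–4394, after `add/sub/xor %X, undef → undef`): "This is safe because all of the output bits are
affected by the undef bits. Any output bit can have a zero or one depending on the input bits."  (L4410–4418, after the `or`/`and`
examples): "These logical operations have bits that are not always affected by the input. For example, if ``%X`` has a zero bit, then the
output of the '``and``' operation will always be a zero for that bit, no matter what the corresponding bit from the '``undef``' is. As such,
it is unsafe to optimize or assume that the result of the '``and``' is '``undef``'. However, it is safe to assume that all bits of the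
'``undef``' could be 0, and optimize the '``and``' to 0. Likewise, it is safe to assume that all the bits of the '``undef``' operand to the
'``or``' could be set, allowing the '``or``' to be folded to -1."  (L4434–4441, `select`): "undefined '``select``' (and conditional branch)
conditions can go *either way*, but they have to come from one of the two operands. […] the optimizer is allowed to assume that the
'``undef``' operand could be the same as ``%Y`` if ``%Y`` is provably not '``poison``' […] This is because '``poison``' is stronger than
'``undef``'."  (L4461–4471, `xor %B, %B`): "two '``undef``' operands are not necessarily the same. […] an '``undef``' "variable" can
arbitrarily change its value over its "live range". […] In fact, ``%A`` and ``%C`` need to have the same semantics or the core LLVM "replace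
all uses with" concept would not hold."  (L4482–4493, `sdiv`): "the ``%A`` operation can be constant folded to '``0``', because the
'``undef``' could be zero, and zero divided by any value is zero. However, in the second example, […] we are allowed to assume that it
could be zero. Since a divide by zero has *undefined behavior*, we are allowed to assume that the operation does not execute at all."
(L4510–4514): "Branching on an undefined value is undefined behavior. […] In case of switch instruction, the branch condition should be
frozen, otherwise it is undefined behavior."  (§'Poison Values', L4558–4559): "It is correct to replace a poison value with an undef value
or any value of the type."  (§'Well-Defined Values', L4607–4608 and L4614–4615): "Given a program execution, a value is *well defined* if
the value does not have an undef bit and is not poison in the execution." / "The result of freeze instruction is well defined regardless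
of its operand."  (§'Parameter Attributes', ``noundef`` L1434–1438): "This attribute applies to parameters and return values. If the value
representation contains any undefined or poison bits, the behavior is undefined."

## What is formalised and what is not
Scalar integers `BitVec sz` (and `Bool` for `i1` conditions).  Only FULLY-undef operands are modelled (`undef = vals univ`) — exactly
Alive2's own restriction ("we only allow an argument to be either fully undef or not undef at all", PLDI'21 §3.2), so "undef bit" granularity
(partially undefined values, L4607) is NOT represented; a "well-defined value" is `defined a`.  The value-set lifts of `sub`/`and`/`or`/`xor`/
`icmp slt`/`sdiv` are `Val.map₂` of the `BitVec` operation (Alive2 Fig. 3 shape, as `Val.add`/`Val.mul` in `LopesEtAl2021`); `select`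
with a SET-valued condition is typed here (`selectV`: poison condition ⇒ poison — the PLDI'17 / Alive2 rule, which the manual's select
section does not state, see `BinaryOperators`' note — ; a condition set containing both truth values yields the JOIN of the two operands, and
a possibly-chosen `poison` operand makes the result `poison`, which is how "unsafe otherwise" in L4428 comes out).  Immediate UB is a
predicate on the operand value set (`DivisorUB` = the typed `Val.udivUB` shape; `BranchUB`).  `%X`, `%Y` in the printed examples are
arbitrary SSA values; the theorems take them well defined (`defined x`) unless the example is about them being `undef`/`poison`, and say so.
Memory examples (L4495–4508: `store undef`, `store to undef`) are outside the memory-free fragment and not typed.  Nothing here is a claim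
about what LLVM's optimiser does; it is the specification text and its own examples.
-/

namespace Literature.Computability.LLVMLangRef18

namespace UndefinedValues

open Literature.Computability.LopesEtAl2021
open Literature.Computability.LopesEtAl2021.Val

variable {α : Type} {sz : ℕ}

/-! ## Value-set lifts of the instructions used in the printed examples (Alive2 Fig. 3 shape) -/

/-- `sub` on value sets (all results over independent picks). [cite: LLVMLangRef18, §'Undefined Values' L4385–4386; LopesEtAl2021, Figure 3] -/
def subV : Val (BitVec sz) → Val (BitVec sz) → Val (BitVec sz) := map₂ (· - ·)
/-- `xor` on value sets. [cite: LLVMLangRef18, §'Undefined Values' L4387; LopesEtAl2021, Figure 3] -/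
def xorV : Val (BitVec sz) → Val (BitVec sz) → Val (BitVec sz) := map₂ (· ^^^ ·)
/-- `or` on value sets. [cite: LLVMLangRef18, §'Undefined Values' L4397; LopesEtAl2021, Figure 3] -/
def orV : Val (BitVec sz) → Val (BitVec sz) → Val (BitVec sz) := map₂ (· ||| ·)
/-- `and` on value sets. [cite: LLVMLangRef18, §'Undefined Values' L4398; LopesEtAl2021, Figure 3] -/
def andV : Val (BitVec sz) → Val (BitVec sz) → Val (BitVec sz) := map₂ (· &&& ·)
/-- `icmp slt` on value sets (result an `i1` value set). [cite: LLVMLangRef18, §'Undefined Values' L4450–4451; LopesEtAl2021, Figure 3] -/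
def icmpSltV : Val (BitVec sz) → Val (BitVec sz) → Val Bool := map₂ fun a b => BitVec.slt a b
/-- `sdiv` on value sets (the VALUE part; the UB part is `DivisorUB`). [cite: LLVMLangRef18, §'Undefined Values' L4478–4479; LopesEtAl2021, Figure 3] -/
def sdivV : Val (BitVec sz) → Val (BitVec sz) → Val (BitVec sz) := map₂ BitVec.sdiv

/-- The join of two values: the value that may be either (a possibly-chosen `poison` is `poison`, else the union of the two sets).
[cite: LLVMLangRef18, §'Undefined Values' L4434–4436 ("can go either way, but they have to come from one of the two operands")] -/
def join : Val α → Val α → Val α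
  | poison, _ => poison
  | vals _, poison => poison
  | vals s, vals t => vals (s ∪ t)

open Classical in
/-- `select` with a SET-valued `i1` condition: a poison condition gives poison (PLDI'17 Fig. 5 / Alive2; the manual's select section is
silent on it); a condition that can only be `1` gives the first operand, only `0` the second; a condition that "can go either way" gives
the `join` (the empty condition set is not an LLVM value; it is sent to `poison`, the top of the refinement order, as a junk value). [cite: LLVMLangRef18, §'Undefined Values' L4422–4441; §'select' L12147–12149] -/
noncomputable def selectV : Val Bool → Val α → Val α → Val α
  | poison, _, _ => poison
  | vals c, t, f => if true ∈ c then (if false ∈ c then join t f else t) else (if false ∈ c then f else poison)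

/-- "The divisor operand of a ``udiv``, ``sdiv``, ``urem`` or ``srem`` instruction" being (possibly) zero or poison is immediate UB —
the same predicate as the typed Alive2 `Val.udivUB`. [cite: LLVMLangRef18, §'Poison Values' L4561–4568; §'Undefined Values' L4486–4493] -/
def DivisorUB : Val (BitVec sz) → Prop
  | poison => True
  | vals t => (0 : BitVec sz) ∈ t

/-- "Branching on an undefined value is undefined behavior" (and on poison, §'Poison Values' L4566): a `br`/`switch` condition whose value is
poison or NOT a single fixed value is UB. [cite: LLVMLangRef18, §'Undefined Values' L4510–4514; §'Poison Values' L4566] -/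
def BranchUB : Val α → Prop
  | poison => True
  | vals c => ¬ ∃ b, c = {b}

/-- The `noundef` parameter / return attribute: "If the value representation contains any undefined or poison bits, the behavior is
undefined" — so a `noundef` value that does not trigger UB is a single well-defined value. [cite: LLVMLangRef18, §'Parameter Attributes'
(``noundef``) L1434–1438] -/
def NoundefOK : Val α → Prop
  | poison => False
  | vals s => ∃ a, s = {a}

/-- "a value is *well defined* if the value does not have an undef bit and is not poison" (fully-undef granularity: a singleton set).
[cite: LLVMLangRef18, §'Well-Defined Values' L4607–4608] -/
def WellDefined (v : Val α) : Prop := ∃ a, v = defined a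

/-! ## Basic facts of the model used below -/

/-- `defined a` unfolds to the singleton set. [cite: LopesEtAl2021, §3] -/
theorem defined_eq (a : α) : (defined a : Val α) = vals {a} := rfl

/-- `undef` unfolds to the full set. [cite: LopesEtAl2021, §2] -/
theorem undef_eq : (undef : Val α) = vals Set.univ := rfl

/-- A `noundef` value that passed the UB check is exactly a well-defined value. [cite: LLVMLangRef18, §'Parameter Attributes' L1434–1438;
§'Well-Defined Values' L4607–4608] -/
theorem noundefOK_iff_wellDefined (v : Val α) : NoundefOK v ↔ WellDefined v := by
  cases v with
  | poison =>
    simp only [NoundefOK, WellDefined, false_iff, not_exists]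
    intro a h
    cases h
  | vals s =>
    simp only [NoundefOK, WellDefined, defined_eq, Val.vals.injEq]

/-- `undef` is NOT an admissible `noundef` argument (in a type with two values), and `poison` never is.
[cite: LLVMLangRef18, §'Parameter Attributes' L1434–1438] -/
theorem not_noundefOK_undef (hsz : 0 < sz) : ¬ NoundefOK (undef : Val (BitVec sz)) ∧ ¬ NoundefOK (poison : Val (BitVec sz)) := by
  refine ⟨fun h => ?_, fun h => h⟩
  simp only [undef_eq, NoundefOK] at h
  obtain ⟨a, ha⟩ := h
  have h0 : (0#sz) ∈ ({a} : Set (BitVec sz)) := ha ▸ Set.mem_univ _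
  have h1 : (1#sz) ∈ ({a} : Set (BitVec sz)) := ha ▸ Set.mem_univ _
  rw [Set.mem_singleton_iff] at h0 h1
  have : (0#sz) = 1#sz := h0.trans h1.symm
  have h2 := congrArg BitVec.toNat this
  simp only [BitVec.toNat_ofNat, Nat.zero_mod] at h2
  rw [Nat.mod_eq_of_lt (Nat.one_lt_two_pow_iff.mpr (by omega))] at h2
  exact absurd h2 (by norm_num)

/-! ## The Note: poison is stronger than undef (L4371–4376; §'Poison Values' L4558–4559) -/

/-- "It is correct to replace a poison value with an undef value or any value of the type" — and NOT conversely: `undef` is not refined by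
`poison` ("Poison values are stronger than undef"). [cite: LLVMLangRef18, §'Poison Values' L4558–4559; §'Undefined Values' L4373–4376] -/
theorem poison_refines_undef_not_conversely :
    Refines (poison : Val α) undef ∧ (∀ a : α, Refines (poison : Val α) (defined a)) ∧ ¬ Refines (undef : Val α) poison :=
  ⟨trivial, fun _ => trivial, fun h => h⟩

/-! ## `add` / `sub` / `xor` with an `undef` operand (L4383–4394): "Safe: %A = undef" -/

/-- `%A = add %X, undef` IS `undef` for a well-defined `%X` ("all of the output bits are affected by the undef bits"): every value `t` is
`x + (t − x)`. [cite: LLVMLangRef18, §'Undefined Values' L4385–4394] -/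
theorem add_defined_undef (x : BitVec sz) : Val.add (defined x) undef = (undef : Val (BitVec sz)) := by
  rw [defined_eq, undef_eq, Val.add, map₂_vals_vals, Val.vals.injEq, Set.eq_univ_iff_forall]
  intro t
  exact ⟨x, rfl, t - x, Set.mem_univ _, by simp⟩

/-- `%B = sub %X, undef` IS `undef`. [cite: LLVMLangRef18, §'Undefined Values' L4386–4394] -/
theorem sub_defined_undef (x : BitVec sz) : subV (defined x) undef = (undef : Val (BitVec sz)) := by
  rw [defined_eq, undef_eq, subV, map₂_vals_vals, Val.vals.injEq, Set.eq_univ_iff_forall]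
  intro t
  exact ⟨x, rfl, x - t, Set.mem_univ _, by simp⟩

/-- `%C = xor %X, undef` IS `undef`. [cite: LLVMLangRef18, §'Undefined Values' L4387–4394] -/
theorem xor_defined_undef (x : BitVec sz) : xorV (defined x) undef = (undef : Val (BitVec sz)) := by
  rw [defined_eq, undef_eq, xorV, map₂_vals_vals, Val.vals.injEq, Set.eq_univ_iff_forall]
  intro t
  refine ⟨x, rfl, x ^^^ t, Set.mem_univ _, ?_⟩
  show x ^^^ (x ^^^ t) = t
  rw [← BitVec.xor_assoc, BitVec.xor_self, BitVec.zero_xor]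

/-- Hence the printed transformations `%A/%B/%C = undef` are refinements (Safe). [cite: LLVMLangRef18, §'Undefined Values' L4383–4394] -/
theorem add_sub_xor_undef_safe (x : BitVec sz) :
    Refines (Val.add (defined x) undef) (undef : Val (BitVec sz)) ∧ Refines (subV (defined x) undef) (undef : Val (BitVec sz)) ∧
      Refines (xorV (defined x) undef) (undef : Val (BitVec sz)) := by
  rw [add_defined_undef, sub_defined_undef, xor_defined_undef]
  exact ⟨refines_refl _, refines_refl _, refines_refl _⟩

/-! ## `or` / `and` with an `undef` operand (L4395–4418) -/

/-- The value set of `or %X, undef`: all `x ||| u`. [cite: LLVMLangRef18, §'Undefined Values' L4397–4418] -/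
theorem or_defined_undef (x : BitVec sz) : orV (defined x) undef = vals {t | ∃ u, t = x ||| u} := by
  rw [defined_eq, undef_eq, orV, map₂_vals_vals, Val.vals.injEq]
  ext t
  simp [eq_comm]

/-- The value set of `and %X, undef`: all `x &&& u`. [cite: LLVMLangRef18, §'Undefined Values' L4398–4418] -/
theorem and_defined_undef (x : BitVec sz) : andV (defined x) undef = vals {t | ∃ u, t = x &&& u} := by
  rw [defined_eq, undef_eq, andV, map₂_vals_vals, Val.vals.injEq]
  ext t
  simp [eq_comm]

/-- Safe: `%A = -1` ("all the bits of the undef operand to the or could be set") and `%A = %X` ("by choosing undef as 0").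
[cite: LLVMLangRef18, §'Undefined Values' L4399–4404 and L4416–4418] -/
theorem or_undef_safe (x : BitVec sz) :
    Refines (orV (defined x) undef) (defined (BitVec.allOnes sz)) ∧ Refines (orV (defined x) undef) (defined x) := by
  rw [or_defined_undef, defined_eq, defined_eq, vals_refines_vals_iff, vals_refines_vals_iff, Set.singleton_subset_iff,
    Set.singleton_subset_iff]
  exact ⟨⟨BitVec.allOnes sz, by simp⟩, ⟨0#sz, by simp⟩⟩

/-- Safe: `%B = 0` ("all bits of the undef could be 0") and `%B = %X` ("by choosing undef as -1").
[cite: LLVMLangRef18, §'Undefined Values' L4399–4404 and L4414–4416] -/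
theorem and_undef_safe (x : BitVec sz) :
    Refines (andV (defined x) undef) (defined (0#sz)) ∧ Refines (andV (defined x) undef) (defined x) := by
  rw [and_defined_undef, defined_eq, defined_eq, vals_refines_vals_iff, vals_refines_vals_iff, Set.singleton_subset_iff,
    Set.singleton_subset_iff]
  exact ⟨⟨0#sz, by simp⟩, ⟨BitVec.allOnes sz, by simp⟩⟩

/-- Unsafe: `%B = undef` for `and` — "if ``%X`` has a zero bit, then the output of the 'and' operation will always be a zero for that bit":
with `%X = 0` the result set is `{0}`, which `undef` does not refine (any width ≥ 1). [cite: LLVMLangRef18, §'Undefined Values'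
L4405–4414] -/
theorem and_undef_unsafe (hsz : 0 < sz) : ¬ Refines (andV (defined (0#sz)) undef) (undef : Val (BitVec sz)) := by
  rw [and_defined_undef, undef_eq, vals_refines_vals_iff]
  intro h
  have h1 := h (Set.mem_univ (BitVec.allOnes sz))
  simp only [BitVec.zero_and, Set.mem_setOf_eq, exists_const] at h1
  have h2 := congrArg BitVec.toNat h1
  rw [BitVec.toNat_allOnes, BitVec.toNat_ofNat, Nat.zero_mod] at h2
  have : 2 ≤ 2 ^ sz := Nat.one_lt_two_pow_iff.mpr (by omega)
  omega

/-- Unsafe: `%A = undef` for `or` — dually, a ONE bit of `%X` forces a one: with `%X = -1` the result set is `{-1}`.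
[cite: LLVMLangRef18, §'Undefined Values' L4405–4414] -/
theorem or_undef_unsafe (hsz : 0 < sz) : ¬ Refines (orV (defined (BitVec.allOnes sz)) undef) (undef : Val (BitVec sz)) := by
  rw [or_defined_undef, undef_eq, vals_refines_vals_iff]
  intro h
  have h1 := h (Set.mem_univ (0#sz))
  simp only [BitVec.allOnes_or, Set.mem_setOf_eq, exists_const] at h1
  have h2 := congrArg BitVec.toNat h1
  rw [BitVec.toNat_allOnes, BitVec.toNat_ofNat, Nat.zero_mod] at h2
  have : 2 ≤ 2 ^ sz := Nat.one_lt_two_pow_iff.mpr (by omega)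
  omega

/-! ## `select` with an `undef` condition or operand (L4420–4441) -/

/-- `%A = select undef, %X, %Y` is "either %X or %Y": the value set `{x, y}` for well-defined operands.
[cite: LLVMLangRef18, §'Undefined Values' L4422–4436] -/
theorem select_undef_cond (x y : α) : selectV (undef : Val Bool) (defined x) (defined y) = vals {x, y} := by
  simp only [undef_eq, selectV, Set.mem_univ, if_true, join, defined_eq]
  rfl

/-- Safe: `%A = %X` (or `%Y`): the condition "can go either way, but [the result has] to come from one of the two operands".
[cite: LLVMLangRef18, §'Undefined Values' L4426 and L4434–4436] -/
theorem select_undef_cond_safe (x y : α) :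
    Refines (selectV (undef : Val Bool) (defined x) (defined y)) (defined x) ∧
      Refines (selectV (undef : Val Bool) (defined x) (defined y)) (defined y) := by
  rw [select_undef_cond, defined_eq, defined_eq, vals_refines_vals_iff, vals_refines_vals_iff]
  exact ⟨by simp, by simp⟩

/-- Unsafe: `%A = undef` — the result must be one of the two operand values; with `%X = %Y = 0` the set is `{0}` (any width ≥ 1).
[cite: LLVMLangRef18, §'Undefined Values' L4430 and L4434–4438] -/
theorem select_undef_cond_unsafe (hsz : 0 < sz) :
    ¬ Refines (selectV (undef : Val Bool) (defined (0#sz)) (defined (0#sz))) (undef : Val (BitVec sz)) := by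
  rw [select_undef_cond, undef_eq, vals_refines_vals_iff]
  intro h
  have h1 := h (Set.mem_univ (BitVec.allOnes sz))
  simp only [Set.mem_insert_iff, Set.mem_singleton_iff, or_self] at h1
  have h2 := congrArg BitVec.toNat h1
  rw [BitVec.toNat_allOnes, BitVec.toNat_ofNat, Nat.zero_mod] at h2
  have : 2 ≤ 2 ^ sz := Nat.one_lt_two_pow_iff.mpr (by omega)
  omega

/-- `%C = select %X, %Y, undef → %Y`: "Safe […] if %Y is provably not poison" — for EVERY condition value (well defined, undef or
poison) the transformation is a refinement when `%Y` is a well-defined value. [cite: LLVMLangRef18, §'Undefined Values' L4424–4428 and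
L4437–4441] -/
theorem select_undef_operand_safe (c : Val Bool) (y : α) : Refines (selectV c (defined y) undef) (defined y) := by
  cases c with
  | poison => exact trivial
  | vals s =>
    simp only [selectV, undef_eq, defined_eq, join]
    split_ifs
    · rw [vals_refines_vals_iff]; simp
    · exact refines_refl _
    · rw [vals_refines_vals_iff]; exact Set.subset_univ _
    · exact trivial

/-- … "unsafe otherwise": if `%Y` is `poison`, the condition value `0` makes the source `undef`, and `undef` is not refined by `poison`
("poison is stronger than undef"). [cite: LLVMLangRef18, §'Undefined Values' L4428 and L4439–4441] -/
theorem select_undef_operand_unsafe :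
    ¬ Refines (selectV (defined false) (poison : Val α) undef) (poison : Val α) := by
  simp [selectV, defined_eq, undef_eq]

/-! ## Two `undef` operands are independent; `%A` and `%C` have the same semantics (L4443–4471) -/

/-- `%A = xor undef, undef` IS `undef`: the two operands pick independently. [cite: LLVMLangRef18, §'Undefined Values' L4445 and L4461–4463] -/
theorem xor_undef_undef : xorV (undef : Val (BitVec sz)) undef = undef := by
  rw [undef_eq, xorV, map₂_vals_vals, Val.vals.injEq, Set.eq_univ_iff_forall]
  intro t
  exact ⟨t, Set.mem_univ _, 0#sz, Set.mem_univ _, by simp⟩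

/-- `%B = undef; %C = xor %B, %B` — "Safe: %C = undef": in the value-set model the two USES of `%B` pick independently, so `%C` is the very
term `xorV undef undef` of `%A` ("%A and %C need to have the same semantics or the core LLVM 'replace all uses with' concept would not
hold"). [cite: LLVMLangRef18, §'Undefined Values' L4447–4448 and L4461–4471] -/
theorem xor_self_undef : (fun B : Val (BitVec sz) => xorV B B) undef = undef := xor_undef_undef

/-- Contrast (the "surprising" part of L4461–4465): for a WELL-DEFINED `%B`, `xor %B, %B` is `0`. [cite: LLVMLangRef18, §'Undefined Values'
L4461–4465] -/
theorem xor_self_defined (x : BitVec sz) : xorV (defined x) (defined x) = defined (0#sz) := by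
  rw [xorV, map₂_defined_defined, BitVec.xor_self]

/-- `%D = undef; %E = icmp slt %D, 4` — "Safe: %E = undef": both truth values occur (at `i32`: `0 <s 4`, `¬ 4 <s 4`).
[cite: LLVMLangRef18, §'Undefined Values' L4450–4459] -/
theorem icmp_slt_undef_four : icmpSltV (undef : Val (BitVec 32)) (defined (4#32)) = undef := by
  rw [undef_eq, defined_eq, icmpSltV, map₂_vals_vals, undef_eq, Val.vals.injEq, Set.eq_univ_iff_forall]
  intro b
  cases b
  · exact ⟨4#32, Set.mem_univ _, 4#32, rfl, by decide⟩
  · exact ⟨0#32, Set.mem_univ _, 4#32, rfl, by decide⟩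

/-! ## Undefined VALUE versus undefined BEHAVIOUR: `sdiv` (L4473–4493) -/

/-- `%A = sdiv undef, %X` — "Safe: %A = 0", "because the undef could be zero, and zero divided by any value is zero".
[cite: LLVMLangRef18, §'Undefined Values' L4476–4485] -/
theorem sdiv_undef_dividend_safe (x : BitVec sz) : Refines (sdivV undef (defined x)) (defined (0#sz)) := by
  rw [undef_eq, defined_eq, defined_eq, sdivV, map₂_vals_vals, vals_refines_vals_iff, Set.singleton_subset_iff]
  exact ⟨0#sz, Set.mem_univ _, x, rfl, BitVec.zero_sdiv⟩

/-- `%B = sdiv %X, undef` — "b: unreachable": the divisor "could be zero. Since a divide by zero has *undefined behavior*, we are allowed to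
assume that the operation does not execute at all". [cite: LLVMLangRef18, §'Undefined Values' L4477–4493] -/
theorem sdiv_undef_divisor_ub : DivisorUB (undef : Val (BitVec sz)) := Set.mem_univ _

/-- `DivisorUB` is the typed Alive2 predicate `Val.udivUB` (same clause for all four division instructions).
[cite: LLVMLangRef18, §'Poison Values' L4567–4568; LopesEtAl2021, Figure 3 (udiv-ub)] -/
theorem divisorUB_iff_udivUB (v : Val (BitVec sz)) : DivisorUB v ↔ Val.udivUB v := by
  cases v <;> rfl

/-- A well-defined non-zero divisor is not UB. [cite: LLVMLangRef18, §'Undefined Values' L4482–4485] -/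
theorem not_divisorUB_defined {x : BitVec sz} (hx : x ≠ 0#sz) : ¬ DivisorUB (defined x) := by
  rw [defined_eq, DivisorUB, Set.mem_singleton_iff]
  exact fun h => hx h.symm

/-! ## Branching on `undef` (L4510–4531) -/

/-- "Branching on an undefined value is undefined behavior": `br undef, BB1, BB2 ; UB`. [cite: LLVMLangRef18, §'Undefined Values' L4510
and L4519] -/
theorem branch_undef_ub : BranchUB (undef : Val Bool) := by
  rintro ⟨b, hb⟩
  have h := Set.mem_univ (!b)
  rw [hb, Set.mem_singleton_iff] at h
  cases b <;> simp at h

/-- A poison condition is UB as well (§'Poison Values' bullet). [cite: LLVMLangRef18, §'Poison Values' L4566] -/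
theorem branch_poison_ub : BranchUB (poison : Val Bool) := trivial

/-- A well-defined condition is not UB. [cite: LLVMLangRef18, §'Undefined Values' L4510–4514] -/
theorem not_branchUB_defined (b : α) : ¬ BranchUB (defined b) := by
  simp [BranchUB, defined_eq]

/-- `%X = freeze i1 undef; br %X, BB1, BB2 ; Well-defined (non-deterministic jump)`: after `freeze` the condition is SOME fixed bit.
[cite: LLVMLangRef18, §'Undefined Values' L4528–4529; §'Well-Defined Values' L4614–4615] -/
theorem branch_freeze_undef_ok (n : Bool) : ¬ BranchUB (Val.freeze (undef : Val Bool) n) :=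
  not_branchUB_defined n

/-- `%X = or i8 undef, 255 ; always 255` — `switch i8 %X … ; Well-defined`: the value set is the singleton `{255}`.
[cite: LLVMLangRef18, §'Undefined Values' L4525–4526] -/
theorem switch_or_undef_255_ok : ¬ BranchUB (orV (undef : Val (BitVec 8)) (defined (255#8))) := by
  have h : orV (undef : Val (BitVec 8)) (defined (255#8)) = defined (255#8) := by
    rw [undef_eq, defined_eq, orV, map₂_vals_vals, Val.vals.injEq]
    ext t
    simp only [Set.mem_image2, Set.mem_univ, true_and, Set.mem_singleton_iff, exists_eq_left]
    constructor
    · rintro ⟨u, rfl⟩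
      have : (255#8) = BitVec.allOnes 8 := by decide
      rw [this, BitVec.or_allOnes]
    · rintro rfl
      exact ⟨0#8, by simp⟩
  rw [h]
  exact not_branchUB_defined _

/-- `%X = and i32 undef, 255 ; switch %X … ; UB`: the value set `{u &&& 255}` contains `0` and `255`, so it is not one fixed value.
[cite: LLVMLangRef18, §'Undefined Values' L4521–4522] -/
theorem switch_and_undef_255_ub : BranchUB (andV (undef : Val (BitVec 32)) (defined (255#32))) := by
  rw [undef_eq, defined_eq, andV, map₂_vals_vals]
  rintro ⟨b, hb⟩
  have h0 : (0#32) ∈ Set.image2 (· &&& ·) (Set.univ : Set (BitVec 32)) {255#32} := ⟨0#32, Set.mem_univ _, 255#32, rfl, by simp⟩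
  have h1 : (255#32) ∈ Set.image2 (· &&& ·) (Set.univ : Set (BitVec 32)) {255#32} := ⟨255#32, Set.mem_univ _, 255#32, rfl, by simp⟩
  rw [hb, Set.mem_singleton_iff] at h0 h1
  have := h0.trans h1.symm
  exact absurd this (by decide)

/-! ## Well-defined values (§'Well-Defined Values' L4602–4615) -/

/-- "The result of freeze instruction is well defined regardless of its operand." [cite: LLVMLangRef18, §'Well-Defined Values' L4614–4615] -/
theorem freeze_wellDefined (v : Val α) (n : α) : WellDefined (Val.freeze v n) := ⟨n, rfl⟩

/-- A constant that is "neither undef constant nor poison constant" is well defined; `undef` (in a type with two values) and `poison` are not.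
[cite: LLVMLangRef18, §'Well-Defined Values' L4607–4613] -/
theorem wellDefined_cases (a : α) (hsz : 0 < sz) :
    WellDefined (defined a) ∧ ¬ WellDefined (undef : Val (BitVec sz)) ∧ ¬ WellDefined (poison : Val (BitVec sz)) := by
  refine ⟨⟨a, rfl⟩, ?_, ?_⟩
  · rw [← noundefOK_iff_wellDefined]; exact (not_noundefOK_undef hsz).1
  · rw [← noundefOK_iff_wellDefined]; exact (not_noundefOK_undef hsz).2

end UndefinedValues

end Literature.Computability.LLVMLangRef18
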